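import Mathlib.Analysis.ODE.Gronwall
import Literature.Probability.RandomPlanarGeometry.LoewnerFlow
import HarnessLib

/-!
# The inverse Loewner maps `f_t` and the backward flow as functions (trunk `Stoch`)

For the chordal Loewner chain in `ℍₒ` driven by a continuous `W : ℝ≥0 → ℝ`
(`Literature.Probability.RandomPlanarGeometry.LoewnerChain`), the tree's `LoewnerFlow` proves
that `g_t = map W t : H_t → ℍₒ` is a conformal equivalence (Lawler (2005), Thm. 4.6), its inverse
being `Function.invFunOn (map W t) (domain W t)`, obtained from solutions of the backward
(time-reversed) Loewner equation. This file names these objects and supplies the quantitative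
API used by the Loewner-trace files `LoewnerHullGrowth`, `LoewnerTraceLimit`,
`SLETraceMeasurability`:

* `Literature.Loewner.loewnerInv W t := Function.invFunOn (map W t) (domain W t)` (an `abbrev`, so that
  all of `LoewnerFlow`'s `invFunOn` lemmas apply verbatim) — `f_t = g_t⁻¹ : ℍₒ → H_t`;
  `map_loewnerInv`, `loewnerInv_map`, `loewnerInv_mem_domain`, `im_loewnerInv_pos`,
  `continuousAt_loewnerInv`; and the bundled `Literature.Loewner.conformalEquivMap hW t :
  ConformalEquiv (domain W t) ℍₒ` (`ConformalEquiv.ofBijOn`, as in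
  `LoewnerFlow.exists_conformalEquiv_map_holds`) whose inverse is `loewnerInv W t` by `rfl`.
* `Literature.Loewner.bwd W t z u := g_{t-u} (f_t z)` — **the backward Loewner flow as a function**
  (no new choice: it is read off the Loewner maps). For `z ∈ ℍₒ` it solves the backward equation
  `ḣ(u) = -2/(h(u) - W(t-u))` on `[0, t]` with `h(0) = z`, `h(t) = f_t(z)`
  (`hasDerivWithinAt_bwd`, `bwd_zero`, `bwd_self`), and `im h ≥ im z` (`im_le_im_bwd`).
* Solutions of the backward equation in general (any `α` with
  `α̇(u) = -vectorField W (t-u) (α u)` on `[0, t]`, `im α(0) > 0`): they move upwards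
  (`im_le_im_of_backward`, first-exit argument), satisfy the **Grönwall estimate**
  `|α u - β u| ≤ |α 0 - β 0| e^{2u/m²}`, `m = min (im α 0) (im β 0)` (`dist_le_of_backward`; the
  field is `2/m²`-Lipschitz on `{im ≥ m}`), hence are unique (`eqOn_of_backward`, `eqOn_bwd`) and
  `bwd` is Lipschitz in the starting point (`dist_bwd_le`, `continuousAt_bwd`). The same
  estimate with an approximate solution gives continuity of `f_t` in the driving function
  (`SLETraceMeasurability.dist_loewnerInv_le_of_driving`).

Nothing of `LoewnerFlow` is restated: the truncated field `bwdField`, existence of backward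
solutions, injectivity/surjectivity/holomorphy of `g_t` and `f_t` are used from there.

## References

* G. F. Lawler, *Conformally Invariant Processes in the Plane*, AMS (2005), Ch. 4 §4.1, Thm. 4.6
  and its proof (the inverse flow `h_s`, eq. (4.7)), Rem. 4.8, Rem. 4.10 (`f_t = g_t⁻¹`).
-/

noncomputable section

open Set Filter Topology Complex Metric
open UpperHalfPlane (upperHalfPlaneSet isOpen_upperHalfPlaneSet)
open scoped NNReal

namespace Literature.Probability.RandomPlanarGeometry

namespace Loewner

variable {W : ℝ≥0 → ℝ} {t : ℝ≥0} {z z' : ℂ} {α β : ℝ → ℂ}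

/-! ### The inverse Loewner map `f_t` -/

/-- The **inverse Loewner map** `f_t = g_t⁻¹ : ℍₒ → H_t`, as the function
`Function.invFunOn (map W t) (domain W t)` of `LoewnerFlow` (an `abbrev`). Lawler (2005),
Rem. 4.10 (`f_t = g_t⁻¹`) and proof of Thm. 4.6. [cite: Lawler2005, Rem. 4.10] -/
abbrev loewnerInv (W : ℝ≥0 → ℝ) (t : ℝ≥0) : ℂ → ℂ := Function.invFunOn (map W t) (domain W t)

/-- A point of `ℍₒ` is off the (real) driving function. [folklore] -/
theorem ne_driving_of_im_pos (hz : 0 < z.im) (s : ℝ≥0) : z ≠ W s := by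
  intro h
  rw [h, Complex.ofReal_im] at hz
  exact lt_irrefl _ hz

/-- `f_t` maps `ℍₒ` into `H_t`. [folklore] -/
theorem loewnerInv_mem_domain (hW : Continuous W) (t : ℝ≥0) (hz : 0 < z.im) :
    loewnerInv W t z ∈ domain W t :=
  (bijOn_invFunOn_map hW t).mapsTo hz

/-- `g_t (f_t z) = z` on `ℍₒ`. [folklore] -/
theorem map_loewnerInv (hW : Continuous W) (t : ℝ≥0) (hz : 0 < z.im) :
    map W t (loewnerInv W t z) = z :=
  (bijOn_map hW t).invOn_invFunOn.2 hz

/-- `f_t (g_t w) = w` on `H_t`. [folklore] -/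
theorem loewnerInv_map (hW : Continuous W) {w : ℂ} (hw : w ∈ domain W t) :
    loewnerInv W t (map W t w) = w :=
  (bijOn_map hW t).invOn_invFunOn.1 hw

/-- `g_t` has positive imaginary part on `H_t`. [folklore] -/
theorem im_map_pos (hW : Continuous W) {w : ℂ} (hw : w ∈ domain W t) : 0 < (map W t w).im :=
  mapsTo_map hW t hw

/-- `f_t` has positive imaginary part on `ℍₒ`. [folklore] -/
theorem im_loewnerInv_pos (hW : Continuous W) (t : ℝ≥0) (hz : 0 < z.im) : 0 < (loewnerInv W t z).im :=
  ((mem_domain_iff W t _).1 (loewnerInv_mem_domain hW t hz)).1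

/-- `f_t` lands beyond the hull: `t < T_{f_t z}`. [folklore] -/
theorem lt_swallowingTime_loewnerInv (hW : Continuous W) (t : ℝ≥0) (hz : 0 < z.im) :
    (t : WithTop ℝ≥0) < swallowingTime W (loewnerInv W t z) :=
  ((mem_domain_iff W t _).1 (loewnerInv_mem_domain hW t hz)).2

/-- `f_t` is continuous at every point of `ℍₒ` (it is holomorphic there,
`LoewnerFlow.hasDerivAt_invFunOn_map`). [folklore] -/
theorem continuousAt_loewnerInv (hW : Continuous W) (t : ℝ≥0) (hz : 0 < z.im) :
    ContinuousAt (loewnerInv W t) z := by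
  obtain ⟨f', -, hd⟩ := hasDerivAt_invFunOn_map hW t hz
  exact hd.continuousAt

/-- **The Loewner map as a bundled conformal equivalence `H_t ≃ ℍₒ`**, with inverse
`loewnerInv W t` definitionally (the witness of `LoewnerFlow.exists_conformalEquiv_map_holds`,
named). Lawler (2005), Thm. 4.6. [cite: Lawler2005, Thm. 4.6] -/
def conformalEquivMap (hW : Continuous W) (t : ℝ≥0) : ConformalEquiv (domain W t) upperHalfPlaneSet :=
  ConformalEquiv.ofBijOn (map W t) (differentiableOn_map hW t) (bijOn_map hW t)
    (differentiableOn_invFunOn_map hW t)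

/-- `conformalEquivMap hW t` acts as `map W t`. [folklore] -/
@[simp]
theorem conformalEquivMap_apply (hW : Continuous W) (t : ℝ≥0) (z : ℂ) :
    conformalEquivMap hW t z = map W t z := rfl

/-- The inverse of `conformalEquivMap hW t` acts as `loewnerInv W t`. [folklore] -/
@[simp]
theorem conformalEquivMap_symm_apply (hW : Continuous W) (t : ℝ≥0) (z : ℂ) :
    (conformalEquivMap hW t).symm z = loewnerInv W t z := rfl

/-! ### The backward field `-vectorField W (t - u)` -/

/-- The imaginary part of the backward field `-vectorField W (t-u) z = -2/(z - W(t-u))`: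
`im (-2/(z - c)) = 2 im z / |z - c|²` for real `c`. [folklore] -/
theorem im_neg_vectorField (W : ℝ≥0 → ℝ) (t : ℝ≥0) (u : ℝ) (z : ℂ) :
    (-vectorField W ((t : ℝ) - u) z).im = 2 * z.im / Complex.normSq (z - W ((t : ℝ) - u).toNNReal) := by
  rw [Complex.neg_im, im_vectorField]
  ring

/-- The imaginary part of the backward field is non-negative in the closed upper half-plane.
[folklore] -/
theorem im_neg_vectorField_nonneg (W : ℝ≥0 → ℝ) (t : ℝ≥0) (u : ℝ) {z : ℂ} (hz : 0 ≤ z.im) :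
    0 ≤ (-vectorField W ((t : ℝ) - u) z).im := by
  rw [im_neg_vectorField]
  exact div_nonneg (by positivity) (Complex.normSq_nonneg _)

/-- Distance to a real point is at least the imaginary part. [folklore] -/
theorem im_le_norm_sub_ofReal (z : ℂ) (c : ℝ) : z.im ≤ ‖z - (c : ℂ)‖ := by
  calc z.im = (z - (c : ℂ)).im := by simp
    _ ≤ |(z - (c : ℂ)).im| := le_abs_self _
    _ ≤ ‖z - (c : ℂ)‖ := Complex.abs_im_le_norm _

/-- The backward field is `2/δ²`-Lipschitz on `{im ≥ δ}` (`δ > 0`). [folklore] -/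
theorem lipschitzOnWith_neg_vectorField (W : ℝ≥0 → ℝ) (t : ℝ≥0) (u : ℝ) {δ : ℝ≥0} (hδ : 0 < δ) :
    LipschitzOnWith (2 / δ ^ 2) (fun w ↦ -vectorField W ((t : ℝ) - u) w) {w : ℂ | (δ : ℝ) ≤ w.im} := by
  have h := (lipschitzOnWith_vectorField W ((t : ℝ) - u) hδ).mono
    (s := {w : ℂ | (δ : ℝ) ≤ w.im}) fun w hw ↦ le_trans hw (im_le_norm_sub_ofReal w _)
  rw [lipschitzOnWith_iff_norm_sub_le] at h ⊢
  intro w hw w' hw'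
  have := h hw hw'
  rwa [neg_sub_neg, norm_sub_rev]

/-- The backward field is bounded by `2/δ` on `{im ≥ δ}` (`δ > 0`). [folklore] -/
theorem norm_neg_vectorField_le (W : ℝ≥0 → ℝ) (t : ℝ≥0) (u : ℝ) {δ : ℝ} (hδ : 0 < δ) {w : ℂ}
    (hw : δ ≤ w.im) : ‖-vectorField W ((t : ℝ) - u) w‖ ≤ 2 / δ := by
  rw [vectorField_apply, norm_neg, norm_div, Complex.norm_two]
  have h1 : δ ≤ ‖w - (W ((t : ℝ) - u).toNNReal : ℂ)‖ := hw.trans (im_le_norm_sub_ofReal w _)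
  exact div_le_div_of_nonneg_left zero_le_two hδ h1

/-! ### Solutions of the backward equation stay in the half-plane above their starting point -/

/-- The imaginary part of a solution of the backward equation, as a real function, has
derivative `2 im α / |α - W|²` within `[0, t]`. [folklore] -/
theorem hasDerivWithinAt_im_of_backward
    (hα : ∀ u ∈ Icc (0 : ℝ) t, HasDerivWithinAt α (-vectorField W ((t : ℝ) - u) (α u)) (Icc (0 : ℝ) t) u)
    {u : ℝ} (hu : u ∈ Icc (0 : ℝ) t) :
    HasDerivWithinAt (fun u ↦ (α u).im) (-vectorField W ((t : ℝ) - u) (α u)).im (Icc (0 : ℝ) t) u :=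
  Complex.imCLM.hasFDerivAt.comp_hasDerivWithinAt u (hα u hu)

/-- If a solution of the backward equation has non-negative imaginary part on `[0, b] ⊆ [0, t]`,
its imaginary part is non-decreasing there. [folklore] -/
theorem monotoneOn_im_of_backward
    (hα : ∀ u ∈ Icc (0 : ℝ) t, HasDerivWithinAt α (-vectorField W ((t : ℝ) - u) (α u)) (Icc (0 : ℝ) t) u)
    {b : ℝ} (hb : b ≤ t) (hpos : ∀ u ∈ Icc (0 : ℝ) b, 0 ≤ (α u).im) :
    MonotoneOn (fun u ↦ (α u).im) (Icc 0 b) := by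
  have hsub : Icc (0 : ℝ) b ⊆ Icc (0 : ℝ) t := Icc_subset_Icc le_rfl hb
  refine monotoneOn_of_hasDerivWithinAt_nonneg (convex_Icc 0 b)
    (fun u hu ↦ ((hasDerivWithinAt_im_of_backward hα (hsub hu)).mono hsub).continuousWithinAt)
    (fun u hu ↦ ((hasDerivWithinAt_im_of_backward hα (hsub (interior_subset hu))).mono
      (interior_subset.trans hsub)))
    fun u hu ↦ im_neg_vectorField_nonneg W t u (hpos u (interior_subset hu))

/-- **A solution of the backward Loewner equation started in `ℍₒ` moves upwards**: its
imaginary part never drops below the initial value (`d/du im h = 2 im h/|h - W|² ≥ 0` as long as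
`im h ≥ 0`, and a first-exit argument). Lawler (2005), Ch. 4 §4.1, proof of Thm. 4.6
("since `Im[h_s(w)]` increases as `s` increases, the solution exists for all `0 ≤ s ≤ t`").
[cite: Lawler2005, Thm. 4.6 (proof)] -/
theorem im_le_im_of_backward
    (hα : ∀ u ∈ Icc (0 : ℝ) t, HasDerivWithinAt α (-vectorField W ((t : ℝ) - u) (α u)) (Icc (0 : ℝ) t) u)
    (h0 : 0 < (α 0).im) : ∀ u ∈ Icc (0 : ℝ) t, (α 0).im ≤ (α u).im := by
  have hcont : ContinuousOn (fun u ↦ (α u).im) (Icc (0 : ℝ) t) := fun u hu ↦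
    (hasDerivWithinAt_im_of_backward hα hu).continuousWithinAt
  -- the bad set `B = {u ∈ [0, t] | im α u ≤ im α 0 / 2}` is empty
  set B : Set ℝ := Icc (0 : ℝ) t ∩ (fun u ↦ (α u).im) ⁻¹' Iic ((α 0).im / 2) with hBdef
  have hB : IsClosed B := hcont.preimage_isClosed_of_isClosed isClosed_Icc isClosed_Iic
  have hBempty : B = ∅ := by
    by_contra hne
    obtain ⟨u₀, hu₀⟩ := nonempty_iff_ne_empty.2 hne
    have hBbdd : BddBelow B := ⟨0, fun s hs ↦ hs.1.1⟩
    set u₁ := sInf B with hu₁def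
    have hu₁B : u₁ ∈ B := hB.csInf_mem ⟨u₀, hu₀⟩ hBbdd
    have hu₁t : u₁ ≤ t := hu₁B.1.2
    have hbefore : ∀ u ∈ Icc (0 : ℝ) u₁, 0 ≤ (α u).im := by
      intro u hu
      rcases eq_or_lt_of_le hu.2 with h | h
      · rw [h]
        have : (α u₁).im ≤ (α 0).im / 2 := hu₁B.2
        by_contra hneg
        -- `im α u₁ ≤ im α 0 / 2` still; we only need non-negativity: compare with `0`
        -- if `im α u₁ < 0` then by continuity some earlier point is in `B` strictly before? use IVT
        rw [not_le] at hneg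
        have hIVT : ∃ s ∈ Icc (0 : ℝ) u₁, (α s).im = (α 0).im / 2 := by
          have hsub : Icc (0 : ℝ) u₁ ⊆ Icc (0 : ℝ) t := Icc_subset_Icc le_rfl hu₁t
          have h1 : (α 0).im / 2 ∈ Icc ((α u₁).im) ((α 0).im) :=
            ⟨by linarith, by linarith⟩
          obtain ⟨s, hs, hseq⟩ :=
            intermediate_value_Icc' hu₁B.1.1 (hcont.mono hsub) h1
          exact ⟨s, hs, hseq⟩
        obtain ⟨s, hs, hseq⟩ := hIVT
        have hsB : s ∈ B := ⟨⟨hs.1, hs.2.trans hu₁t⟩, le_of_eq hseq⟩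
        have hsu₁ : u₁ ≤ s := csInf_le hBbdd hsB
        have hs_eq : s = u₁ := le_antisymm hs.2 hsu₁
        rw [hs_eq] at hseq
        linarith
      · by_contra hneg
        rw [not_le] at hneg
        have huB : u ∈ B := ⟨⟨hu.1, h.le.trans hu₁t⟩, by
          show (α u).im ≤ (α 0).im / 2
          linarith⟩
        exact absurd (csInf_le hBbdd huB) (not_le.2 h)
    have hmono := monotoneOn_im_of_backward hα hu₁t hbefore
    have hle : (α 0).im ≤ (α u₁).im :=
      hmono ⟨le_rfl, hu₁B.1.1⟩ ⟨hu₁B.1.1, le_rfl⟩ hu₁B.1.1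
    have : (α u₁).im ≤ (α 0).im / 2 := hu₁B.2
    linarith
  have hpos : ∀ u ∈ Icc (0 : ℝ) t, 0 ≤ (α u).im := by
    intro u hu
    by_contra hneg
    rw [not_le] at hneg
    have huB : u ∈ B := ⟨hu, by
      show (α u).im ≤ (α 0).im / 2
      linarith⟩
    rw [hBempty] at huB
    exact huB
  intro u hu
  exact monotoneOn_im_of_backward hα le_rfl hpos ⟨le_rfl, hu.1.trans hu.2⟩ hu hu.1

/-- A solution of the backward equation is continuous on `[0, t]`. [folklore] -/
theorem continuousOn_of_backward
    (hα : ∀ u ∈ Icc (0 : ℝ) t, HasDerivWithinAt α (-vectorField W ((t : ℝ) - u) (α u)) (Icc (0 : ℝ) t) u) :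
    ContinuousOn α (Icc (0 : ℝ) t) := fun u hu ↦ (hα u hu).continuousWithinAt

/-- One-sided derivatives of a solution of the backward equation, within `[u, ∞)` for
`u ∈ [0, t)`. [folklore] -/
theorem hasDerivWithinAt_Ici_of_backward
    (hα : ∀ u ∈ Icc (0 : ℝ) t, HasDerivWithinAt α (-vectorField W ((t : ℝ) - u) (α u)) (Icc (0 : ℝ) t) u)
    {u : ℝ} (hu : u ∈ Ico (0 : ℝ) t) :
    HasDerivWithinAt α (-vectorField W ((t : ℝ) - u) (α u)) (Ici u) u := by
  have h1 : HasDerivWithinAt α (-vectorField W ((t : ℝ) - u) (α u)) (Icc u t) u :=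
    (hα u ⟨hu.1, hu.2.le⟩).mono fun s hs ↦ ⟨hu.1.trans hs.1, hs.2⟩
  exact h1.mono_of_mem_nhdsWithin (Icc_mem_nhdsGE hu.2)

/-- **Grönwall estimate for the backward Loewner flow**: two solutions of the backward
equation on `[0, t]` started in `ℍₒ` satisfy `|α u - β u| ≤ |α 0 - β 0| e^{2u/m²}` with
`m = min (im α 0) (im β 0)` (both stay in `{im ≥ m}`, where the field is `2/m²`-Lipschitz).
[folklore] -/
theorem dist_le_of_backward
    (hα : ∀ u ∈ Icc (0 : ℝ) t, HasDerivWithinAt α (-vectorField W ((t : ℝ) - u) (α u)) (Icc (0 : ℝ) t) u)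
    (hβ : ∀ u ∈ Icc (0 : ℝ) t, HasDerivWithinAt β (-vectorField W ((t : ℝ) - u) (β u)) (Icc (0 : ℝ) t) u)
    (hα0 : 0 < (α 0).im) (hβ0 : 0 < (β 0).im) :
    ∀ u ∈ Icc (0 : ℝ) t, dist (α u) (β u) ≤
      dist (α 0) (β 0) * Real.exp (2 / (min (α 0).im (β 0).im) ^ 2 * u) := by
  set m : ℝ := min (α 0).im (β 0).im with hmdef
  have hm : 0 < m := lt_min hα0 hβ0
  set mn : ℝ≥0 := ⟨m, hm.le⟩ with hmndef
  have hmn : 0 < mn := hm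
  have key := dist_le_of_trajectories_ODE_of_mem (v := fun u w ↦ -vectorField W ((t : ℝ) - u) w)
    (s := fun _ ↦ {w : ℂ | (mn : ℝ) ≤ w.im}) (K := 2 / mn ^ 2) (δ := dist (α 0) (β 0))
    (f := α) (g := β) (a := 0) (b := t)
    (fun u _ ↦ lipschitzOnWith_neg_vectorField W t u hmn) (continuousOn_of_backward hα)
    (fun u hu ↦ hasDerivWithinAt_Ici_of_backward hα hu)
    (fun u hu ↦ (min_le_left _ _).trans (im_le_im_of_backward hα hα0 u ⟨hu.1, hu.2.le⟩))
    (continuousOn_of_backward hβ)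
    (fun u hu ↦ hasDerivWithinAt_Ici_of_backward hβ hu)
    (fun u hu ↦ (min_le_right _ _).trans (im_le_im_of_backward hβ hβ0 u ⟨hu.1, hu.2.le⟩))
    le_rfl
  intro u hu
  have := key u hu
  have hK : ((2 / mn ^ 2 : ℝ≥0) : ℝ) = 2 / m ^ 2 := by
    simp only [NNReal.coe_div, NNReal.coe_pow, NNReal.coe_ofNat, hmndef]
    rfl
  rwa [hK, sub_zero] at this

/-- **Uniqueness for the backward Loewner flow** started in `ℍₒ`. [folklore] -/
theorem eqOn_of_backward
    (hα : ∀ u ∈ Icc (0 : ℝ) t, HasDerivWithinAt α (-vectorField W ((t : ℝ) - u) (α u)) (Icc (0 : ℝ) t) u)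
    (hβ : ∀ u ∈ Icc (0 : ℝ) t, HasDerivWithinAt β (-vectorField W ((t : ℝ) - u) (β u)) (Icc (0 : ℝ) t) u)
    (hα0 : 0 < (α 0).im) (h0 : α 0 = β 0) : EqOn α β (Icc (0 : ℝ) t) := by
  intro u hu
  have hβ0 : 0 < (β 0).im := h0 ▸ hα0
  have := dist_le_of_backward hα hβ hα0 hβ0 u hu
  rw [h0, dist_self, zero_mul] at this
  exact dist_le_zero.1 this

/-! ### The backward Loewner flow as a function -/

/-- The **backward Loewner flow** from time `t` started at `z`, as a function:
`bwd W t z u = g_{t-u} (f_t z)` (for `u ∈ [0, t]`; the Loewner maps carry their own junk values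
elsewhere). For `z ∈ ℍₒ` this is the solution `h` of the inverse-flow equation
`ḣ(u) = -2/(h(u) - W(t-u))`, `h(0) = z`, of the proof of Lawler (2005), Thm. 4.6 (Rem. 4.8:
`ḣ_s = -V(t-s, h_s)`), with `h(t) = f_t(z)`. [cite: Lawler2005, Thm. 4.6 (proof) and Rem. 4.8] -/
def bwd (W : ℝ≥0 → ℝ) (t : ℝ≥0) (z : ℂ) : ℝ → ℂ :=
  fun u ↦ map W (((t : ℝ) - u).toNNReal) (loewnerInv W t z)

/-- The backward flow read off a solution from `f_t z`: `bwd W t z u = G (t - u)` on `[0, t]`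
for the maximal solution `G` started at `f_t z`. [folklore] -/
theorem bwd_eq_of_isSolution (hW : Continuous W) (hz : 0 < z.im) {G : ℝ → ℂ}
    (hG : IsSolution W (loewnerInv W t z) G (swallowingTime W (loewnerInv W t z))) {u : ℝ}
    (hu : u ∈ Icc (0 : ℝ) t) : bwd W t z u = G ((t : ℝ) - u) := by
  have htT := lt_swallowingTime_loewnerInv hW t hz
  have h1 : (((t : ℝ) - u).toNNReal : WithTop ℝ≥0) < swallowingTime W (loewnerInv W t z) :=
    lt_of_le_of_lt (WithTop.coe_le_coe.2 (Real.toNNReal_le_iff_le_coe.2 (sub_le_self _ hu.1))) htT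
  show map W (((t : ℝ) - u).toNNReal) (loewnerInv W t z) = G ((t : ℝ) - u)
  rw [map_eq_of_isSolution hW hG h1, Real.coe_toNNReal _ (sub_nonneg.2 hu.2)]

/-- The backward flow starts at `z` (`g_t (f_t z) = z`). [folklore] -/
theorem bwd_zero (hW : Continuous W) (t : ℝ≥0) (hz : 0 < z.im) : bwd W t z 0 = z := by
  show map W (((t : ℝ) - 0).toNNReal) (loewnerInv W t z) = z
  rw [sub_zero, Real.toNNReal_coe, map_loewnerInv hW t hz]

/-- The backward flow ends at `f_t z` (`g_0 = id`). [folklore] -/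
theorem bwd_self (hW : Continuous W) (t : ℝ≥0) (hz : 0 < z.im) : bwd W t z t = loewnerInv W t z := by
  show map W (((t : ℝ) - t).toNNReal) (loewnerInv W t z) = loewnerInv W t z
  rw [sub_self, Real.toNNReal_zero]
  exact map_zero_apply hW (ne_driving_of_im_pos (im_loewnerInv_pos hW t hz) 0)

/-- **The backward flow solves the backward Loewner equation** on `[0, t]` (time reversal of the
forward solution from `f_t z`). [folklore] -/
theorem hasDerivWithinAt_bwd (hW : Continuous W) (t : ℝ≥0) (hz : 0 < z.im) :
    ∀ u ∈ Icc (0 : ℝ) t,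
      HasDerivWithinAt (bwd W t z) (-vectorField W ((t : ℝ) - u) (bwd W t z u)) (Icc (0 : ℝ) t) u := by
  intro u hu
  obtain ⟨G, hG⟩ := exists_isSolution_swallowingTime_holds hW
    (ne_driving_of_im_pos (im_loewnerInv_pos hW t hz) 0)
  have htT' : ((t : ℝ).toNNReal : WithTop ℝ≥0) < swallowingTime W (loewnerInv W t z) := by
    rw [Real.toNNReal_coe]
    exact lt_swallowingTime_loewnerInv hW t hz
  have hsub := Icc_subset_timeDomain htT'
  have htu : (t : ℝ) - u ∈ Icc (0 : ℝ) t := ⟨sub_nonneg.2 hu.2, sub_le_self _ hu.1⟩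
  have h1 : HasDerivWithinAt G (vectorField W ((t : ℝ) - u) (G ((t : ℝ) - u))) (Icc (0 : ℝ) t)
      ((t : ℝ) - u) := (hG.isIntegralCurveOn _ (hsub htu)).mono hsub
  have h2 : HasDerivWithinAt (fun u : ℝ ↦ (t : ℝ) - u) (-1) (Icc (0 : ℝ) t) u := by
    simpa using (hasDerivWithinAt_id u (Icc (0 : ℝ) t)).const_sub (t : ℝ)
  have h3 := h1.scomp u h2 (fun s hs ↦ ⟨sub_nonneg.2 hs.2, sub_le_self _ hs.1⟩)
  rw [neg_one_smul] at h3
  have heq : EqOn (G ∘ fun u : ℝ ↦ (t : ℝ) - u) (bwd W t z) (Icc (0 : ℝ) t) := fun s hs ↦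
    (bwd_eq_of_isSolution hW hz hG hs).symm
  rw [bwd_eq_of_isSolution hW hz hG hu]
  exact h3.congr (fun s hs ↦ (heq hs).symm) (heq hu).symm

/-- Along the backward flow from `z ∈ ℍₒ` the imaginary part stays `≥ im z` (the forward flow
decreases imaginary parts, `LoewnerFlow.IsSolution.im_antitoneOn`). [folklore] -/
theorem im_le_im_bwd (hW : Continuous W) (t : ℝ≥0) (hz : 0 < z.im) :
    ∀ u ∈ Icc (0 : ℝ) t, z.im ≤ (bwd W t z u).im := by
  intro u hu
  obtain ⟨G, hG⟩ := exists_isSolution_swallowingTime_holds hW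
    (ne_driving_of_im_pos (im_loewnerInv_pos hW t hz) 0)
  have htT := lt_swallowingTime_loewnerInv hW t hz
  have htT' : ((t : ℝ).toNNReal : WithTop ℝ≥0) < swallowingTime W (loewnerInv W t z) := by
    rwa [Real.toNNReal_coe]
  have hsub := Icc_subset_timeDomain htT'
  have hanti := hG.im_antitoneOn hW (im_loewnerInv_pos hW t hz)
  have h1 : (G t).im ≤ (G ((t : ℝ) - u)).im :=
    hanti (hsub ⟨sub_nonneg.2 hu.2, sub_le_self _ hu.1⟩) (hsub ⟨t.coe_nonneg, le_rfl⟩)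
      (sub_le_self _ hu.1)
  rw [bwd_eq_of_isSolution hW hz hG hu, ← map_eq_of_isSolution hW hG htT, map_loewnerInv hW t hz] at *
  exact h1

/-- The backward flow from `z ∈ ℍₒ` stays in `ℍₒ`. [folklore] -/
theorem im_bwd_pos (hW : Continuous W) (t : ℝ≥0) (hz : 0 < z.im) {u : ℝ}
    (hu : u ∈ Icc (0 : ℝ) t) : 0 < (bwd W t z u).im :=
  hz.trans_le (im_le_im_bwd hW t hz u hu)

/-- The backward flow is continuous on `[0, t]`. [folklore] -/
theorem continuousOn_bwd (hW : Continuous W) (t : ℝ≥0) (hz : 0 < z.im) :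
    ContinuousOn (bwd W t z) (Icc (0 : ℝ) t) :=
  continuousOn_of_backward (hasDerivWithinAt_bwd hW t hz)

/-- **Uniqueness**: every solution of the backward equation from `z ∈ ℍₒ` is `bwd W t z` on
`[0, t]`. [folklore] -/
theorem eqOn_bwd (hW : Continuous W) (t : ℝ≥0) (hz : 0 < z.im) (hα0 : α 0 = z)
    (hα : ∀ u ∈ Icc (0 : ℝ) t, HasDerivWithinAt α (-vectorField W ((t : ℝ) - u) (α u)) (Icc (0 : ℝ) t) u) :
    EqOn α (bwd W t z) (Icc (0 : ℝ) t) :=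
  eqOn_of_backward hα (hasDerivWithinAt_bwd hW t hz) (by rw [hα0]; exact hz)
    (by rw [hα0, bwd_zero hW t hz])

/-- **Lipschitz dependence of the backward flow on the starting point** (Grönwall). Lawler (2005),
proof of Thm. 4.6, eq. (4.7). [cite: Lawler2005, Thm. 4.6, eq. (4.7)] -/
theorem dist_bwd_le (hW : Continuous W) (t : ℝ≥0) (hz : 0 < z.im) (hz' : 0 < z'.im) :
    ∀ u ∈ Icc (0 : ℝ) t, dist (bwd W t z u) (bwd W t z' u) ≤
      dist z z' * Real.exp (2 / (min z.im z'.im) ^ 2 * u) := by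
  have h := dist_le_of_backward (hasDerivWithinAt_bwd hW t hz) (hasDerivWithinAt_bwd hW t hz')
    (by rw [bwd_zero hW t hz]; exact hz) (by rw [bwd_zero hW t hz']; exact hz')
  rw [bwd_zero hW t hz, bwd_zero hW t hz'] at h
  exact h

/-- A point within `im z / 2` of `z` has imaginary part `> im z / 2`. [folklore] -/
theorem half_im_lt_im_of_dist_lt {z z' : ℂ} (h : dist z' z < z.im / 2) : z.im / 2 < z'.im := by
  have h1 : |(z' - z).im| ≤ ‖z' - z‖ := Complex.abs_im_le_norm _
  rw [Complex.sub_im, ← dist_eq_norm] at h1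
  have := (abs_lt.1 (lt_of_le_of_lt h1 h)).1
  linarith

/-- **Continuous dependence of the backward flow on the starting point.** [folklore] -/
theorem continuousAt_bwd (hW : Continuous W) (t : ℝ≥0) (hz : 0 < z.im) {u : ℝ}
    (hu : u ∈ Icc (0 : ℝ) t) : ContinuousAt (fun z' ↦ bwd W t z' u) z := by
  rw [Metric.continuousAt_iff]
  intro ε hε
  set y₁ : ℝ := z.im / 2 with hy₁
  have hy₁pos : 0 < y₁ := by positivity
  set M : ℝ := Real.exp (2 / y₁ ^ 2 * t) with hM
  have hMpos : 0 < M := Real.exp_pos _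
  refine ⟨min y₁ (ε / M), lt_min hy₁pos (div_pos hε hMpos), fun z' hz' ↦ ?_⟩
  have hz'1 : dist z' z < y₁ := lt_of_lt_of_le hz' (min_le_left _ _)
  have hz'im : y₁ < z'.im := half_im_lt_im_of_dist_lt hz'1
  have hz'pos : 0 < z'.im := hy₁pos.trans hz'im
  have hmin : y₁ ≤ min z'.im z.im := le_min hz'im.le (by linarith)
  have h := dist_bwd_le hW t hz'pos hz u hu
  have hexp : Real.exp (2 / (min z'.im z.im) ^ 2 * u) ≤ M := by
    apply Real.exp_le_exp.2
    apply mul_le_mul _ hu.2 hu.1 (by positivity)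
    exact div_le_div_of_nonneg_left zero_le_two (by positivity)
      (pow_le_pow_left₀ hy₁pos.le hmin 2)
  calc dist (bwd W t z' u) (bwd W t z u)
      ≤ dist z' z * Real.exp (2 / (min z'.im z.im) ^ 2 * u) := h
    _ ≤ dist z' z * M := mul_le_mul_of_nonneg_left hexp dist_nonneg
    _ < ε / M * M := mul_lt_mul_of_pos_right (lt_of_lt_of_le hz' (min_le_right _ _)) hMpos
    _ = ε := div_mul_cancel₀ ε hMpos.ne'

end Loewner

end Literature.Probability.RandomPlanarGeometry
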